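import Summits.ResolutionOfSingularities.ResolutionOfSingularities.Theorems.HomologicalConductorNoZenoSplitCoverFloor
import HarnessLib

/-!
# Crux `NoZenoR` (stmt-ResolutionOfSingularities-19943), slots 3/4 — the TWO-TERM FLOOR:
# `J² ⊆ ca⁴(A)` whenever every second syzygy has a two-term resolution by `J`-stably-annihilated modules

Route `ResolutionOfSingularities/HomologicalConductor`, chain W4.4, KERNEL-g14 §1 (lead g14).
`[OURS]` — the abstract (Lean) half of the halved depth floor «TR² ⊆ ca on isolated quotient threefold
singularities in good characteristic»; NOT a statement of any manuscript; AI-formalised, weaker than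
expert review.

KERNEL-g13 §3.1 / `…NoZenoSplitCoverFloor.lean` (p612053): for a split `A`-algebra `B` with
`ca^{d+1}(B) = ⊤`, `(ann_A Ext^{≥1}(B|_A, −))^{d+1} ⊆ ca^{d+1}(A)` — four factors on a threefold,
because a general module is reached from `add(B|_A)` in `d + 1 = 4` steps.  When the modules of a
class `𝒞` resolve every SECOND SYZYGY in TWO terms — `0 → C₁ → C₀ → Ω²M → 0` exact, `C₀, C₁ ∈ 𝒞`
— two factors suffice:

* `mul_mem_extAnnihilatorFrom_two_of_shortExact` — if `0 → C₁ → C₀ → K → 0` is short exact,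
  `a` kills `Ext^{≥1}(C₀, −)` and `b` kills `Ext^{≥1}(C₁, −)`, then `a·b` kills `Ext^{≥2}(K, −)`
  (one use of `SplitCoverFloor.mul_smul_ext_eq_zero_of_shortExact_X₃`);
* `sq_le_cohomologyAnnihilatorOfDegree_four_of_twoTermResolution` — **if every finitely generated
  `M` has a second syzygy `K = Ω²M` with such a resolution by modules on which the ideal `J` kills
  `Ext^{≥1}`, then `J² ⊆ ca⁴(A)`** (dimension shift `Ext^{≥2}(Ω²M, −) = Ext^{≥4}(M, −)`,
  `mem_extAnnihilatorFrom_of_isSyzygy`);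
* `sq_le_cohomologyAnnihilator_of_twoTermResolution` — hence `J² ⊆ ca(A)`.

The input «every second syzygy (indeed every MCM module) over an isolated quotient singularity
`k[[V]]^G`, `G ⊂ GL₃` small, `|G| ∈ kˣ`, has an exact `0 → C₁ → C₀ → X → 0` with `C_i ∈ add S`» is
Iyama's theorem that `add S` is a maximal 1-orthogonal subcategory of `CM(S^G)` [Iyama 2007,
Thm 2.5 with Thm 2.2.3 / Lemma 2.2.4; printed for char 0]; with `J = TR = sann_A(S)` (which kills
`Ext^{≥1}` of every summand of `S`) this file turns it into `TR² ⊆ ca⁴` — the floor that closes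
census row 8″ (E-ZENO3-σ′) of chain W4.4 (KERNEL-g14 §3).  That input is NOT typed here (no
invariant-ring / orthogonal-subcategory vocabulary in the tree); this file is the reusable
homological half only, exactly as p612053 is for the four-factor floor.
-/

noncomputable section

-- single-problem summit: the doubled namespace component is forced
set_option linter.dupNamespace false

open CategoryTheory CategoryTheory.Abelian CategoryTheory.Limits
open Literature.RingTheory.CohomologyAnnihilator
open Summit.ResolutionOfSingularities.ResolutionOfSingularities.Theorems.NoZeno.SplitCoverFloor
  (mul_smul_ext_eq_zero_of_shortExact_X₃)

universe u

namespace Summit.ResolutionOfSingularities.ResolutionOfSingularities.Theorems.NoZeno.TwoTermFloor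

variable {A : Type u} [CommRing A]

/-- **Two-term annihilation.** If `0 → C₁ → C₀ → K → 0` is short exact, `a` kills `Ext^{≥1}(C₀, −)`
and `b` kills `Ext^{≥1}(C₁, −)` (finitely generated second argument), then `a · b` kills
`Ext^{≥2}(K, −)`: `a · ξ` restricts to `0` on `C₀`, so it is a connecting image `∂η` with
`η ∈ Ext^{i-1}(C₁, −)`, `i - 1 ≥ 1`, and `b · η = 0`. [folklore] -/
theorem mul_mem_extAnnihilatorFrom_two_of_shortExact {S : ShortComplex (ModuleCat.{u} A)}
    (hS : S.ShortExact) {a b : A} (ha : a ∈ extAnnihilatorFrom S.X₂ 1)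
    (hb : b ∈ extAnnihilatorFrom S.X₁ 1) : a * b ∈ extAnnihilatorFrom S.X₃ 2 := by
  rw [mem_extAnnihilatorFrom_iff] at ha hb ⊢
  intro i hi N hN e
  obtain ⟨i', rfl⟩ : ∃ i', i = i' + 1 := ⟨i - 1, by omega⟩
  rw [mul_comm]
  exact mul_smul_ext_eq_zero_of_shortExact_X₃ hS (hb i' (by omega) N hN) (ha (i' + 1) (by omega) N hN) e

/-- **The two-term floor: `J² ⊆ ca⁴(A)`.** Suppose every finitely generated `A`-module `M` has a
second syzygy `K = Ω²M` sitting in a short exact sequence `0 → C₁ → C₀ → K → 0` such that the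
ideal `J` kills `Ext^{≥1}(C₀, −)` and `Ext^{≥1}(C₁, −)`. Then `J² ⊆ ca⁴(A)`:
`J² · Ext^{≥2}(Ω²M, −) = 0` by two-term annihilation, and `Extⁱ(M, −) ↞ Ext^{i−2}(Ω²M, −)`
(dimension shifting). Model: `A` an isolated quotient threefold singularity in good characteristic,
`C_i ∈ add S`, `J = TR` [Iyama 2007, Thm 2.5]. [this work] -/
theorem sq_le_cohomologyAnnihilatorOfDegree_four_of_twoTermResolution (J : Ideal A)
    (h : ∀ (M : ModuleCat.{u} A), Module.Finite A M →
      ∃ (K : ModuleCat.{u} A) (S : ShortComplex (ModuleCat.{u} A)), IsSyzygy 2 M K ∧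
        S.ShortExact ∧ Nonempty (S.X₃ ≅ K) ∧
        J ≤ extAnnihilatorFrom S.X₂ 1 ∧ J ≤ extAnnihilatorFrom S.X₁ 1) :
    J ^ 2 ≤ cohomologyAnnihilatorOfDegree A 4 := by
  rw [pow_two, Ideal.mul_le]
  intro a ha b hb
  rw [mem_cohomologyAnnihilatorOfDegree_iff_forall_mem_extAnnihilatorFrom]
  intro M hM
  obtain ⟨K, S, hK, hS, ⟨eKS⟩, hJ₀, hJ₁⟩ := h M hM
  have hab : a * b ∈ extAnnihilatorFrom S.X₃ 2 :=
    mul_mem_extAnnihilatorFrom_two_of_shortExact hS (hJ₀ ha) (hJ₁ hb)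
  have habK : a * b ∈ extAnnihilatorFrom K 2 := by
    rw [mem_extAnnihilatorFrom_iff] at hab ⊢
    intro i hi N hN e
    exact ext_smul_eq_zero_of_iso eKS (Iso.refl N) (a * b) (hab i hi N hN) e
  exact mem_extAnnihilatorFrom_of_isSyzygy 2 hK habK

/-- **Hence `J² ⊆ ca(A)`** under the same two-term hypothesis. [this work] -/
theorem sq_le_cohomologyAnnihilator_of_twoTermResolution (J : Ideal A)
    (h : ∀ (M : ModuleCat.{u} A), Module.Finite A M →
      ∃ (K : ModuleCat.{u} A) (S : ShortComplex (ModuleCat.{u} A)), IsSyzygy 2 M K ∧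
        S.ShortExact ∧ Nonempty (S.X₃ ≅ K) ∧
        J ≤ extAnnihilatorFrom S.X₂ 1 ∧ J ≤ extAnnihilatorFrom S.X₁ 1) :
    J ^ 2 ≤ cohomologyAnnihilator A :=
  (sq_le_cohomologyAnnihilatorOfDegree_four_of_twoTermResolution J h).trans
    (cohomologyAnnihilatorOfDegree_le 4)

/-! ## One-sided annihilation through a LEFT approximation (KERNEL-g14 §3.6 (c)) -/

/-- **One-sided annihilation.** If `0 → X → C⁰ → C¹ → 0` is short exact, `a` kills
`Ext^{j+1}(C¹, N)` and `Extʲ(C⁰, N) = 0`, then `a` kills `Extʲ(X, N)`: `∂(a·ξ) = a·∂ξ = 0`, so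
`a·ξ` comes from `Extʲ(C⁰, N) = 0`. Model (KERNEL-g14 §3.6 (c)): `X` MCM over an isolated quotient
threefold singularity, `X → C⁰` its left `add S`-approximation [Iyama 2007, Thm 2.2.3], `a ∈ TR`,
`N ∈ add S` (where `Ext¹(add S, add S) = 0`): then `TR · Ext^{≥1}(CM R, add S) = 0` — which is why an
`Ext` probe with targets in `add S` can never see an element of `TR` outside `ca`. [this work] -/
theorem smul_ext_eq_zero_of_shortExact_X₁ {S : ShortComplex (ModuleCat.{u} A)} (hS : S.ShortExact)
    {N : ModuleCat.{u} A} {j : ℕ} {a : A} (ha : ∀ e : Ext.{u} S.X₃ N (j + 1), a • e = 0)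
    (h0 : ∀ e : Ext.{u} S.X₂ N j, e = 0) (e : Ext.{u} S.X₁ N j) : a • e = 0 := by
  have hδ : hS.extClass.comp (a • e) (add_comm 1 j) = 0 := by
    rw [Ext.comp_smul, ha]
  obtain ⟨x₂, hx₂⟩ := Ext.contravariant_sequence_exact₁ hS N (a • e) (add_comm 1 j) hδ
  rw [← hx₂, h0 x₂, Ext.comp_zero]

/-- The same in `extAnnihilatorFrom` form: if `a ∈ ann Ext^{≥ l+1}(C¹, −)` and `Ext^{≥ l}(C⁰, N) = 0`
for every finitely generated `N` in a class `P` then `a` kills `Ext^{≥ l}(X, N)` for `N ∈ P`,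
`l ≥ 1`. [this work] -/
theorem smul_ext_eq_zero_of_shortExact_X₁_of_mem {S : ShortComplex (ModuleCat.{u} A)}
    (hS : S.ShortExact) {l : ℕ} {a : A} (ha : a ∈ extAnnihilatorFrom S.X₃ (l + 1))
    (P : ModuleCat.{u} A → Prop)
    (h0 : ∀ N : ModuleCat.{u} A, P N → ∀ i : ℕ, l ≤ i → ∀ e : Ext.{u} S.X₂ N i, e = 0)
    {N : ModuleCat.{u} A} (hN : P N) (hNf : Module.Finite A N) {i : ℕ} (hi : l ≤ i)
    (e : Ext.{u} S.X₁ N i) : a • e = 0 := by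
  rw [mem_extAnnihilatorFrom_iff] at ha
  exact smul_ext_eq_zero_of_shortExact_X₁ hS (fun e' => ha (i + 1) (by omega) N hNf e')
    (h0 N hN i hi) e

end Summit.ResolutionOfSingularities.ResolutionOfSingularities.Theorems.NoZeno.TwoTermFloor

end
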